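import Summits.BirchSwinnertonDyer.BirchSwinnertonDyer.Theses.KolyvaginRankRigidityAtTwo
import HarnessLib

/-!
# Route `KolyvaginRankRigidityAtTwo`: the item-level link V1′∞ ⇒ V1′θ —
# `KolyvaginStrongNonzeroSystemAtTwo` (stmt-BirchSwinnertonDyer-27983, crux r2) implies
# `KolyvaginNonvanishingAtTwoFrameTheta` (stmt-BirchSwinnertonDyer-27219, support) BY NAME

Width seat `bsd-line-krr2-p2` g8; asked for by idea-crit-5 VERDICT #107 (A) («V1′∞ ⇏ V1′θ by automation — true by the
pub lemma `theta_of_strongSystem`; land it, it is the item-level link»). The lead's turnkey lemma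
(`Cruxes/KolyvaginCorankLowerBoundAtTwo/RICH_RESTATEMENT.lean`, `RichTurnkey.theta_of_strongSystem`) re-typed against
the two ROUTE decls of rev 26: forget the depth `r`. CONDITIONAL on V1′∞ (an open item: Kolyvagin's conjecture at
`2`, strong form) — it closes nothing by itself; BSD is NOT proved by this.
-/

set_option autoImplicit false
-- the Theorems namespace of this sub repeats the summit name by design (D-0017 nested layout)
set_option linter.dupNamespace false

namespace Summit.BirchSwinnertonDyer.BirchSwinnertonDyer.Theorems.KolyvaginAtTwo

open Summit.BirchSwinnertonDyer.BirchSwinnertonDyer.Theses.KolyvaginRankRigidityAtTwo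

/-- **V1′∞ ⇒ V1′θ** (items 27983 ⇒ 27219, route decls): a strong non-zero system at some depth `r` gives, for
every `θ, k`, a non-zero `(θ, k)`-strong class — forget the depth. [cite: Kolyvagin1991MathAnn, p. 259 (2.1)] -/
theorem nonvanishingAtTwoFrameTheta_of_strongNonzeroSystem (h : KolyvaginStrongNonzeroSystemAtTwo) :
    KolyvaginNonvanishingAtTwoFrameTheta := by
  intro W _ _ hCM hred hsur K _ _ hK _ hHN hodd hne3 htor hH2 Dt β ι hβ θ k
  obtain ⟨r, hr⟩ := h W hCM hred hsur K hK hHN hodd hne3 htor hH2 Dt β ι hβ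
  obtain ⟨n, d, M, hn, -, hM1, hMle, hne⟩ := hr θ k
  exact ⟨n, d, M, hn, hM1, hMle, hne⟩

end Summit.BirchSwinnertonDyer.BirchSwinnertonDyer.Theorems.KolyvaginAtTwo
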